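import Summits.QuantumFields.YangMills.Theorems.BalabanUVNodesN15TwoSpacingGluingCubes
import HarnessLib

/-!
# THE GLUING STEP AT TWO LATTICE SPACINGS, VIII: the `W`-COMMUTATOR LETTER for a BLOCK-LOCAL summand (`W = Q*aQ`): `[P, M_h] = P∘M_{δh} − M_{δh}∘P` with `δh = h − h̄∘blk`
# the in-block oscillation of the partition, hence `[P, M_h]∘G_□ ≤ 1_S1_S·2pωβ·e^{−δd}` (`ω = O(M⁻¹)`) and its η-defect — FILE 46's displayed `θ_W`, `r_W` DISCHARGED for the
# averaging term (dag-n15-c g11, FILE 51; N15 = NE2, s1 «background-layer OPERATOR ingredient»)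

Cell `pub-ymgap`, seat `pub-ymgap-dag-n15-c` (R134 (a); HUMAN RULING D-0062), generation 11.  `bears_on: R4∕N15 · K3⁷ SpineGivenEndpointR13SepCoPH (stmt-QuantumFields-20544)`.
Filed `--supports stmt-QuantumFields-20544 --as helper` — COUNT-NEUTRAL.  Theorems only (0 `def`, 0 `sorry`).  Imports BY NAME FILE 45 `…N15TwoSpacingGluingCubes` (`commOp`, `hasMaj_diag_comp`,
`hasMaj_comp_diag`; through it lit `T4EtaRateCoeffDefect.hasMaj_mulOp`∕`hasMaj_idef_mulOp`, `B6Prop26Gluing.mulOp`∕`ind`); nothing in the tree is modified.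

WHY.  FILE 46 wrote `Δ_a = Σ_μ∇_μ*∇_μ + W` and displayed the commutator letter of `W` (`[W, M_h]G_□ ≤ 1_S1_S·θ_We^{−δd}` and its two-grid defect `r_W`).  For the AVERAGING summand `W = Q*aQ` of
[B9] (3.26) ∕ [B6] (2.92) the operator is BLOCK-LOCAL (it commutes with multiplication by block-constant functions and is bounded block-diagonally), so `[W, M_h] = W∘M_{δh} − M_{δh}∘W` with
`δh = h − h̄∘blk` the oscillation of the partition function over ONE unit block — `O(M⁻¹)` for [B6]'s `h_□` (p.229).  THIS FILE types that: ★ `commOp_blockLocal` (the identity), ★★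
`hasMaj_commOp_blockLocal_comp` (`[P, M_h]∘G ≤ 1_S1_S·2pωβe^{−δd}` from `P ≤ diagK p`, `|δh| ≤ ω`, `G ≤ 1_S1_S·βe^{−δd}`), ★★ `hasMaj_idef_commOp_blockLocal_comp` (its η-defect from the cube's
entry-0 defect `m`, the oscillation's fit `o`, and a block-diagonal fit `𝔇(P′, P) ≤ diagK o_P` — ZERO for King's block means, lit-free here).

HONEST FRAMING ∕ LIMITS.  Algebra + diagonal block-majorant bookkeeping ([B9] (3.26) p.395, [B6] (2.92) p.239 = SHAPES; nothing asserted).  The block-locality (`P∘M_{c∘blk} = M_{c∘blk}∘P`),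
the block-diagonal majorants and the PURE fit `𝔇(P′,P) ≤ diagK o_P` are hypotheses (true for King block means `Q*Q`; Bałaban's line-filtered `Q_k` has a derivative-consuming two-grid fit —
not this shape, said); the `DRD*` summand ([B6] (2.93)) is not treated.  NE2⁺ NOT PRINTED, NOT proved; N15 NOT discharged; counts of record UNMOVED (typed 28∕28 · discharged 5∕27); one finite
𝕋⁴ at fixed ε — NOT infinite volume, NOT OS on ℝ⁴, NOT a mass gap, NOT Clay; R4 closes the conditional finite-𝕋⁴ rung `BalabanLadder.UV` only.  Restate-immune (no Theses import).
-/

noncomputable section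

namespace Summit.QuantumFields.YangMills.BalabanUVNodes.N15.Gluing

open Literature.MathematicalPhysics.QuantumFieldTheory.Balaban1983to89
open Literature.MathematicalPhysics.QuantumFieldTheory.Balaban1983to89.B11SectG (BlockNorm HasMaj)
open Literature.MathematicalPhysics.QuantumFieldTheory.Balaban1983to89.T4EtaRateDefect (idef idef_apply idef_comp idef_sub)
open Literature.MathematicalPhysics.QuantumFieldTheory.Balaban1983to89.T4EtaRateCoeffDefect (pull pull_apply diagK diagK_nonneg hasMaj_mulOp hasMaj_idef_mulOp)
open Literature.MathematicalPhysics.QuantumFieldTheory.Balaban1983to89.B6Prop26Gluing (mulOp mulOp_apply ind ind_nonneg ind_le_one)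

section BlockLocal

variable {X X' : Type} [Fintype X] [Fintype X'] {g : B6.Geometry} (blk : X → g.Site) (π : X' → X)

omit [Fintype X] [Fintype X'] in
/-- `M_{a+b} = M_a + M_b`. [folklore] -/
theorem mulOp_add (a b : X → ℝ) : mulOp (a + b) = mulOp a + mulOp b := by
  refine LinearMap.ext fun f => funext fun x => ?_
  simp only [mulOp_apply, Pi.add_apply, LinearMap.add_apply]
  ring

omit [Fintype X] [Fintype X'] in
/-- ★ **THE COMMUTATOR OF A BLOCK-LOCAL OPERATOR WITH A MULTIPLICATION**: if `P` commutes with the block-constant part `M_{h̄∘blk}` of `M_h`, then `[P, M_h] = P∘M_{δh} − M_{δh}∘P` with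
`δh = h − h̄∘blk`. [cite: Balaban1984PropagatorsII, (2.92) p.239 (shape)] -/
theorem commOp_blockLocal {P : (X → ℝ) →ₗ[ℝ] (X → ℝ)} {h : X → ℝ} {hb : g.Site → ℝ} (hcomm : P ∘ₗ mulOp (hb ∘ blk) = mulOp (hb ∘ blk) ∘ₗ P) :
    commOp P h = P ∘ₗ mulOp (h - hb ∘ blk) - mulOp (h - hb ∘ blk) ∘ₗ P := by
  have hsplit : h = hb ∘ blk + (h - hb ∘ blk) := by abel
  conv_lhs => rw [commOp, hsplit]
  rw [mulOp_add, LinearMap.comp_add, LinearMap.add_comp, hcomm]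
  abel

/-- ★★ **THE `W`-LETTER OF FILE 46 FOR A BLOCK-LOCAL SUMMAND**: `P ≤ diagK p`, `|δh| ≤ ω`, `G ≤ 1_S1_S·βe^{−δd}` ⟹ `[P, M_h]∘G ≤ 1_S1_S·2pωβ·e^{−δd}` (`θ_W = 2pωβ`, `ω = O(M⁻¹)`).
[cite: Balaban1984PropagatorsII, (2.134) p.247 (shape)] -/
theorem hasMaj_commOp_blockLocal_comp {P G : (X → ℝ) →ₗ[ℝ] (X → ℝ)} {h : X → ℝ} {hb : g.Site → ℝ} {S : Set g.Site} {p ω β δ : ℝ} (hp : 0 ≤ p) (hω : 0 ≤ ω)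
    (hcomm : P ∘ₗ mulOp (hb ∘ blk) = mulOp (hb ∘ blk) ∘ₗ P) (hP : HasMaj (BlockNorm.ofBlocks g blk) (BlockNorm.ofBlocks g blk) P (diagK fun _ => p))
    (hosc : ∀ x, |h x - hb (blk x)| ≤ ω)
    (hG : HasMaj (BlockNorm.ofBlocks g blk) (BlockNorm.ofBlocks g blk) G (fun y y' => ind S y * ind S y' * (β * Real.exp (-(δ * g.dist y y'))))) :
    HasMaj (BlockNorm.ofBlocks g blk) (BlockNorm.ofBlocks g blk) (commOp P h ∘ₗ G) (fun y y' => ind S y * ind S y' * (2 * p * ω * β * Real.exp (-(δ * g.dist y y')))) := by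
  have hM := hasMaj_mulOp (g := g) blk (a := h - hb ∘ blk) (m := fun _ => ω) (fun _ => hω) (fun x => by simpa using hosc x)
  have t1 := hasMaj_diag_comp blk (fun _ => hp) hP (hasMaj_diag_comp blk (fun _ => hω) hM hG)
  have t2 := hasMaj_diag_comp blk (fun _ => hω) hM (hasMaj_diag_comp blk (fun _ => hp) hP hG)
  rw [commOp_blockLocal blk hcomm, LinearMap.sub_comp, LinearMap.comp_assoc, LinearMap.comp_assoc]
  refine (t1.sub t2).mono fun y y' => le_of_eq ?_
  ring

/-- ★★ **ITS η-DEFECT** from the cube's entry-0 defect `𝔇(G′,G) ≤ 1_S1_S·me^{−δd}`, the fit of the oscillation `|δh′ − δh∘π| ≤ o`, the fine letters `P′ ≤ diagK p`, `|δh′| ≤ ω`, the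
coarse `G ≤ 1_S1_S·βe^{−δd}`, and a PURE block-diagonal fit `𝔇(P′, P) ≤ diagK o_P`: `𝔇([P′,M_{h′}]G′, [P,M_h]G) ≤ 1_S1_S·2(pωm + poβ + o_Pωβ)·e^{−δd}`.
[cite: Balaban1985BackgroundPropagators, Thm 3.14 pp.426–427 (difference template)] -/
theorem hasMaj_idef_commOp_blockLocal_comp {P G : (X → ℝ) →ₗ[ℝ] (X → ℝ)} {P' G' : (X' → ℝ) →ₗ[ℝ] (X' → ℝ)} {h : X → ℝ} {h' : X' → ℝ} {hb hb' : g.Site → ℝ} {S : Set g.Site}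
    {p ω β m o oP δ : ℝ} (hp : 0 ≤ p) (hω : 0 ≤ ω) (ho : 0 ≤ o) (hoP : 0 ≤ oP)
    (hcomm : P ∘ₗ mulOp (hb ∘ blk) = mulOp (hb ∘ blk) ∘ₗ P) (hcomm' : P' ∘ₗ mulOp (hb' ∘ (blk ∘ π)) = mulOp (hb' ∘ (blk ∘ π)) ∘ₗ P')
    (hP : HasMaj (BlockNorm.ofBlocks g blk) (BlockNorm.ofBlocks g blk) P (diagK fun _ => p))
    (hP' : HasMaj (BlockNorm.ofBlocks g (blk ∘ π)) (BlockNorm.ofBlocks g (blk ∘ π)) P' (diagK fun _ => p))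
    (hosc : ∀ x, |h x - hb (blk x)| ≤ ω) (hosc' : ∀ x', |h' x' - hb' (blk (π x'))| ≤ ω)
    (hfit : ∀ x', |(h' x' - hb' (blk (π x'))) - (h (π x') - hb (blk (π x')))| ≤ o)
    (hG : HasMaj (BlockNorm.ofBlocks g blk) (BlockNorm.ofBlocks g blk) G (fun y y' => ind S y * ind S y' * (β * Real.exp (-(δ * g.dist y y')))))
    (hDG : HasMaj (BlockNorm.ofBlocks g blk) (BlockNorm.ofBlocks g (blk ∘ π)) (idef (pull π) (pull π) G' G) (fun y y' => ind S y * ind S y' * (m * Real.exp (-(δ * g.dist y y')))))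
    (hDP : HasMaj (BlockNorm.ofBlocks g blk) (BlockNorm.ofBlocks g (blk ∘ π)) (idef (pull π) (pull π) P' P) (diagK fun _ => oP)) :
    HasMaj (BlockNorm.ofBlocks g blk) (BlockNorm.ofBlocks g (blk ∘ π)) (idef (pull π) (pull π) (commOp P' h' ∘ₗ G') (commOp P h ∘ₗ G))
      (fun y y' => ind S y * ind S y' * (2 * (p * ω * m + p * o * β + oP * ω * β) * Real.exp (-(δ * g.dist y y')))) := by
  have hM := hasMaj_mulOp (g := g) blk (a := h - hb ∘ blk) (m := fun _ => ω) (fun _ => hω) (fun x => by simpa using hosc x)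
  have hM' := hasMaj_mulOp (g := g) (blk ∘ π) (a := h' - hb' ∘ (blk ∘ π)) (m := fun _ => ω) (fun _ => hω) (fun x' => by simpa using hosc' x')
  have hDM := hasMaj_idef_mulOp (g := g) blk π (a' := h' - hb' ∘ (blk ∘ π)) (a := h - hb ∘ blk) (o := fun _ => o) (fun _ => ho) (fun x' => by simpa using hfit x')
  -- 𝔇(P′M′G′, PMG) = P′(M′𝔇G + 𝔇M G) + 𝔇P (M G)
  have a1 := hasMaj_diag_comp (blk ∘ π) (fun _ => hp) hP' (hasMaj_diag_comp (blk ∘ π) (fun _ => hω) hM' hDG)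
  have a2 := hasMaj_diag_comp (blk ∘ π) (fun _ => hp) hP' (hasMaj_diag_comp blk (fun _ => ho) hDM hG)
  have a3 := hasMaj_diag_comp blk (fun _ => hoP) hDP (hasMaj_diag_comp blk (fun _ => hω) hM hG)
  -- 𝔇(M′P′G′, MPG) = M′(P′𝔇G + 𝔇P G) + 𝔇M (P G)
  have b1 := hasMaj_diag_comp (blk ∘ π) (fun _ => hω) hM' (hasMaj_diag_comp (blk ∘ π) (fun _ => hp) hP' hDG)
  have b2 := hasMaj_diag_comp (blk ∘ π) (fun _ => hω) hM' (hasMaj_diag_comp blk (fun _ => hoP) hDP hG)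
  have b3 := hasMaj_diag_comp blk (fun _ => ho) hDM (hasMaj_diag_comp blk (fun _ => hp) hP hG)
  have hop : idef (pull π) (pull π) (commOp P' h' ∘ₗ G') (commOp P h ∘ₗ G) =
      (P' ∘ₗ (mulOp (h' - hb' ∘ (blk ∘ π)) ∘ₗ idef (pull π) (pull π) G' G + idef (pull π) (pull π) (mulOp (h' - hb' ∘ (blk ∘ π))) (mulOp (h - hb ∘ blk)) ∘ₗ G) +
          idef (pull π) (pull π) P' P ∘ₗ (mulOp (h - hb ∘ blk) ∘ₗ G)) -
        (mulOp (h' - hb' ∘ (blk ∘ π)) ∘ₗ (P' ∘ₗ idef (pull π) (pull π) G' G + idef (pull π) (pull π) P' P ∘ₗ G) +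
          idef (pull π) (pull π) (mulOp (h' - hb' ∘ (blk ∘ π))) (mulOp (h - hb ∘ blk)) ∘ₗ (P ∘ₗ G)) := by
    rw [commOp_blockLocal blk hcomm, commOp_blockLocal (blk ∘ π) hcomm', LinearMap.sub_comp, LinearMap.sub_comp, LinearMap.comp_assoc, LinearMap.comp_assoc,
      LinearMap.comp_assoc, LinearMap.comp_assoc, idef_sub, idef_comp (pull π) (pull π) (pull π), idef_comp (pull π) (pull π) (pull π), idef_comp (pull π) (pull π) (pull π),
      idef_comp (pull π) (pull π) (pull π)]
  rw [hop]
  refine (((a1.add a2).add a3).sub ((b1.add b2).add b3)).congr (fun μ => ?_) |>.mono fun y y' => le_of_eq ?_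
  · simp only [LinearMap.sub_apply, LinearMap.add_apply, LinearMap.comp_apply, map_add]
  · ring

end BlockLocal

end Summit.QuantumFields.YangMills.BalabanUVNodes.N15.Gluing

end
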